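import Literature.MathematicalPhysics.QuantumFieldTheory.SUNBakryEmeryPoincare
import HarnessLib

/-!
# Conjugation invariance of frame sums of squares on `𝔰𝔲(N)`: left- and right-invariant carrés du champ coincide

Sequel of `SUNBakryEmeryFrame` / `SUNBakryEmeryPoincare` (the Parseval frame `(Y_α)` of `𝔰𝔲(N)` for the Hilbert–Schmidt
product, `frameGrad`, `matD`, `Gam`).  Shen–Zhu–Zhu (CMP 400 (2023) §2, p. 10–11, (2.3)–(2.4)) compute `|∇F|²` on `SU(N)` in an
orthonormal basis of RIGHT-invariant vector fields `X̃(Q) = XQ`, whereas the Bakry–Émery files of the tree (`matD A F Q = dF(Q)[QA]`,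
`Gam`) use LEFT-invariant fields `Q ↦ QA`; for the bi-invariant metric both give the squared norm of the gradient.  Here:

* ★ `sum_sq_apply_frame_mul_eq_sum_sq_apply_mul_frame` — for every real-linear functional `λ` on `M_N(ℂ)` and every unitary `Q`,
  `∑_α λ(Y_α Q)² = ∑_α λ(Q Y_α)²`: the family `(Qᴴ Y_α Q)` is again a Parseval frame of `𝔰𝔲(N)` — via the Riesz representer
  `Z_λ ∈ 𝔰𝔲(N)` (`frameGrad`), `λ(X) = −Re tr(X Z_λ)` on `𝔰𝔲(N)`, Parseval `∑_α (Re tr(Y_α B))² = ‖B‖_F²` on `𝔰𝔲(N)` and the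
  unitary invariance `‖Q Z Qᴴ‖_F = ‖Z‖_F`;
* ★ `Gam_eq_sum_sq_fderiv_mul` — consequently `Γ(F,F)(Q) = ∑_α (dF(Q)[Y_α Q])²` for `Q ∈ SU(N)`: the tree's (left-invariant) carré du
  champ equals the right-invariant one (the shape of `linkGradSq` in `LatticeYangMillsUniformLogSobolev` and of the noise fields
  `√2·𝐩(E_n)·Q` of the SZZ lattice Langevin dynamics `latticeLangevinDynamics`).

THEOREMS ONLY.  [cite: ShenZhuZhuCMP2023, §2 (2.3)–(2.4) (p. 10)] for the setting; the linear algebra is folklore.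
-/

noncomputable section

namespace Literature.MathematicalPhysics.QuantumFieldTheory

namespace SUNBakryEmery

open scoped Matrix ComplexConjugate BigOperators
open Matrix Complex Finset

variable {N : ℕ}

/-- Conjugates `Qᴴ Y Q` of a skew-Hermitian `Y` are skew-Hermitian. [folklore] -/
private theorem conjTranspose_conj_of_skew {Y Q : Matrix (Fin N) (Fin N) ℂ} (hY : Yᴴ = -Y) :
    (Qᴴ * Y * Q)ᴴ = -(Qᴴ * Y * Q) := by
  rw [conjTranspose_mul, conjTranspose_mul, conjTranspose_conjTranspose, hY, Matrix.neg_mul, Matrix.mul_neg, Matrix.mul_assoc]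

/-- Conjugates `Qᴴ Y Q` of a traceless `Y` by a unitary `Q` (`Q Qᴴ = 1`) are traceless. [folklore] -/
private theorem trace_conj_of_trace_eq_zero {Y Q : Matrix (Fin N) (Fin N) ℂ} (hQ : Q * Qᴴ = 1) (hY : Y.trace = 0) :
    (Qᴴ * Y * Q).trace = 0 := by
  rw [Matrix.mul_assoc, trace_mul_comm, Matrix.mul_assoc, hQ, Matrix.mul_one, hY]

/-- Unitary invariance of the Frobenius norm on skew-Hermitian matrices: `‖Q A Qᴴ‖_F² = ‖A‖_F²` (`Qᴴ Q = 1`). [folklore] -/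
private theorem frobNorm_sq_conj_of_skew {A Q : Matrix (Fin N) (Fin N) ℂ} (hA : Aᴴ = -A) (hQ : Qᴴ * Q = 1) :
    frobNorm (Q * A * Qᴴ) ^ 2 = frobNorm A ^ 2 := by
  have hB : (Q * A * Qᴴ)ᴴ = -(Q * A * Qᴴ) := by
    rw [conjTranspose_mul, conjTranspose_mul, conjTranspose_conjTranspose, hA, Matrix.neg_mul, Matrix.mul_neg, Matrix.mul_assoc]
  rw [frobNorm_sq_of_skew hB, frobNorm_sq_of_skew hA]
  congr 2
  calc (Q * A * Qᴴ * (Q * A * Qᴴ)).trace = (Q * (A * (Qᴴ * Q) * A) * Qᴴ).trace := by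
        simp only [Matrix.mul_assoc]
    _ = (Q * (A * A) * Qᴴ).trace := by rw [hQ, Matrix.mul_one]
    _ = (Qᴴ * (Q * (A * A))).trace := by rw [trace_mul_comm]
    _ = (A * A).trace := by rw [← Matrix.mul_assoc, hQ, Matrix.one_mul]

/-- ★ **Left/right invariance of the frame sum of squares**: for every real-linear functional `λ` on `M_N(ℂ)` (`N ≥ 1`) and every
unitary `Q`, `∑_α λ(Y_α Q)² = ∑_α λ(Q Y_α)²` — the conjugated family `(Qᴴ Y_α Q)` is again a Parseval frame of `𝔰𝔲(N)`.
[cite: ShenZhuZhuCMP2023, §2 (2.3)–(2.4) (p. 10)] -/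
theorem sum_sq_apply_frame_mul_eq_sum_sq_apply_mul_frame (hN : N ≠ 0) (lam : Matrix (Fin N) (Fin N) ℂ →ₗ[ℝ] ℝ)
    {Q : Matrix (Fin N) (Fin N) ℂ} (hQ : Q * Qᴴ = 1) (hQ' : Qᴴ * Q = 1) :
    ∑ α, lam (frame α * Q) ^ 2 = ∑ α, lam (Q * frame α) ^ 2 := by
  -- `λ_L(Y) = λ(QY)`, a real-linear functional; its Riesz representer `A ∈ 𝔰𝔲(N)`
  set lamL : Matrix (Fin N) (Fin N) ℂ →ₗ[ℝ] ℝ := lam.comp (LinearMap.mulLeft ℝ Q) with hlamL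
  have hlamL_apply : ∀ Y, lamL Y = lam (Q * Y) := fun Y => rfl
  set A : Matrix (Fin N) (Fin N) ℂ := frameGrad lamL with hAdef
  have hA : Aᴴ = -A := frameGrad_conjTranspose lamL
  have hA0 : A.trace = 0 := frameGrad_trace hN lamL
  -- right side `= ‖A‖_F²`
  have hR : ∑ α, lam (Q * frame α) ^ 2 = frobNorm A ^ 2 := by
    rw [frobNorm_frameGrad_sq hN lamL]
    exact sum_congr rfl fun α _ => by rw [hlamL_apply]
  -- left side: `λ(Y_α Q) = λ_L(Qᴴ Y_α Q) = −Re tr(Y_α · Q A Qᴴ)`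
  set B : Matrix (Fin N) (Fin N) ℂ := Q * A * Qᴴ with hBdef
  have hB : Bᴴ = -B := by
    rw [hBdef, conjTranspose_mul, conjTranspose_mul, conjTranspose_conjTranspose, hA, Matrix.neg_mul, Matrix.mul_neg,
      Matrix.mul_assoc]
  have hB0 : B.trace = 0 := by
    rw [hBdef, Matrix.mul_assoc, trace_mul_comm, Matrix.mul_assoc, hQ', Matrix.mul_one, hA0]
  have hL1 : ∀ α : FrameIdx N, lam (frame α * Q) = -((frame α * B).trace.re) := by
    intro α
    have e1 : frame α * Q = Q * (Qᴴ * frame α * Q) := by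
      rw [← Matrix.mul_assoc, ← Matrix.mul_assoc, hQ, Matrix.one_mul]
    rw [e1, ← hlamL_apply, apply_eq_neg_re_trace_mul_frameGrad hN lamL (conjTranspose_conj_of_skew (frame_conjTranspose α))
      (trace_conj_of_trace_eq_zero hQ (frame_trace hN α))]
    congr 2
    rw [← hAdef, hBdef]
    calc (Qᴴ * frame α * Q * A).trace = (Qᴴ * (frame α * (Q * A))).trace := by simp only [Matrix.mul_assoc]
      _ = (frame α * (Q * A) * Qᴴ).trace := by rw [trace_mul_comm, Matrix.mul_assoc]
      _ = (frame α * (Q * A * Qᴴ)).trace := by simp only [Matrix.mul_assoc]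
  have hL : ∑ α, lam (frame α * Q) ^ 2 = frobNorm B ^ 2 := by
    rw [← sum_sq_re_trace_frame_mul hN hB hB0]
    refine sum_congr rfl fun α _ => ?_
    rw [hL1 α, neg_sq]
  rw [hL, hR, hBdef, frobNorm_sq_conj_of_skew hA hQ']

open scoped Matrix.Norms.Frobenius in
/-- ★ **The carré du champ in right-invariant form**: for `Q ∈ SU(N)` (`N ≥ 1`) and any `F : M_N(ℂ) → ℝ`,
`Γ(F,F)(Q) = ∑_α (dF(Q)[Q Y_α])² = ∑_α (dF(Q)[Y_α Q])²` (`fderiv` for the Frobenius norm, as in `linkGradSq`). [cite: ShenZhuZhuCMP2023, §2 (2.3)–(2.4) (p. 10)] -/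
theorem Gam_eq_sum_sq_fderiv_mul (hN : N ≠ 0) (F : Matrix (Fin N) (Fin N) ℂ → ℝ) {Q : Matrix (Fin N) (Fin N) ℂ}
    (hQ : Q ∈ Matrix.specialUnitaryGroup (Fin N) ℂ) :
    Gam F F Q = ∑ α, (fderiv ℝ F Q (frame α * Q)) ^ 2 := by
  have hU : Q ∈ Matrix.unitaryGroup (Fin N) ℂ := hQ.1
  have hQ1 : Q * Qᴴ = 1 := Matrix.mem_unitaryGroup_iff.1 hU
  have hQ2 : Qᴴ * Q = 1 := Matrix.mem_unitaryGroup_iff'.1 hU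
  have h := sum_sq_apply_frame_mul_eq_sum_sq_apply_mul_frame hN ((fderiv ℝ F Q).toLinearMap) hQ1 hQ2
  simp only [ContinuousLinearMap.coe_coe] at h
  rw [h]
  simp only [Gam, matD_apply, sq]
  rfl

end SUNBakryEmery

end Literature.MathematicalPhysics.QuantumFieldTheory

end
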